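import Literature.NumberTheory.Automorphic.ShimuraCurveRibetTakahashiBrandtCoordinatesProofs
import Literature.NumberTheory.Automorphic.ShimuraCurveRibetTakahashiPairwiseEisensteinProofs
import HarnessLib

/-!
# Pasten's Thm. 6.1 (b) from the character-group dictionary: Thm. 2.3 on the level side and the
# Eisenstein divisibility are algebra, Lemma 6.7 above `163` is Mazur's theorem

Topic `NumberTheory/Automorphic`; a proofs-only companion (theorems only: no definition, no named
fact, nothing restated; D-0026) of `ShimuraCurveRibetTakahashi.lean`, written by the seat of its
named fact `Literature.NumberTheory.Automorphic.PastenShimura2024_thm_6_1_b` (H. Pasten, *Shimura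
curves and the abc conjecture*, J. Number Theory 254 (2024) 214–335 = arXiv:1705.09251, Thm. 6.1 (b)
p. 20), continuing `ShimuraCurveRibetTakahashiBrandtCoordinatesProofs.lean`.

**The point.** That file proved `PastenShimura2024_thm_6_1_b` from six named facts and four printed
theorems taken as hypotheses over the tree's Brandt modules: (`hTlev`) Takahashi 2001 Thm. 2.3 for
`X₀^D(M)` at `p ∥ M`, (`hT2`) Thm. 2.3 at `p ∣ D`, (`hEis`) Ribet's Eisenstein property of
`Φ_p(J₀^D(M))` in coordinates, (`h67`) Pasten's Lemma 6.7. For the two-prime case `d = 1` the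
parallel seat of `PastenShimura2024_pairwise_denominator` then showed
(`…PairwiseEisensteinProofs.lean`) that two and a half of these are ALGEBRA over one geometric input,
the character-group dictionary of Takahashi §2 / p. 84 — the form in which the tree names the
`D = 1` inputs of Takahashi's theorem (`takahashi2001_characterGroupDictionary`,
`takahashi2001_brandtEigenLattice_rank_one`, `TakahashiDegreeFormulaFromDictionary.lean`). This file
runs that reduction for EVERY `d ∣ D`, i.e. for the whole telescoping of §6.9:

1. **`hTlev` and `hEis` are algebra over the dictionary.** Given, for the optimal quotient
   `q : J₀^D(pm) → A` and a Brandt setup `S` of type `(m, Dp)` (Takahashi p. 84, Buzzard 1997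
   Thm. 4.7: `X_p(J₀^D(pm)) ≅ ℤ[Cls O]⁰`, Hecke- and pairing-compatibly), the character-group data
   inside `ℤ^{Cls O}` — a saturated sublattice `Y` containing every vector of degree zero (Ribet
   1990 Prop. 3.1 / Takahashi p. 84: it IS the degree-zero lattice `ℤ[Cls O]⁰`),
   `π^* : X_p(A) = ℤ → Y`, `π_* : Y → ℤ` adjoint for Gross's pairing `Σ_c w_c x_c y_c` and
   `u_A(a, b) = c_p(A) a b` (SGA 7 IX 11.5; `c_p = ord_p Δ_min`, Tate), `π_* π^* = δ_{D,M}`, `π_*`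
   onto (optimality), `π^* 1` in the `a(A)`-eigen-lattice, which has rank one (multiplicity one) —
   Takahashi's Lemma 2.2 / Thm. 2.3 are the tree's abstract `Takahashi2001.exists_index_formula`, and
   "`i_p ∣ 12 (ℓ + 1 − a_ℓ)`" (Ribet's Eisenstein property up to the harmless factor `12 = lcm(w_c)`)
   is Eichler's weight symmetry plus column sums `ℓ + 1` (the parallel seat's
   `Brandt.XiSetup.dvd_twelve_mul_sub_of_forall_dvd`, Gross 1987 §2). This is
   `exists_image_coker_eisenstein_of_brandtData_general` — the engine of
   `…PairwiseEisensteinProofs` for a Brandt setup of ANY type `(N⁺, N⁻)` and an abstract degree `δ`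
   (there: type `(M, r)`, `δ = P.modularDegree` of a classical datum), with `c > 0` now DERIVED
   (`π^* 1 = j g ≠ 0` and Gross's pairing is positive definite, `w_c ∣ 12`).
2. **`h67` above `163` is Mazur's theorem + Chebotarev**, both in the tree (named fact
   `mazur_isogeny_irreducible`; theorem
   `exists_prime_not_dvd_lFunction_sub_of_hasIrreducibleModPGaloisRep`), assembled by the parallel
   seat as `exists_dvd_of_eisenstein12_of_mazur`: Lemma 6.14 with the factor `12`, needing Pasten's
   Lemma 6.7 only for the primes `ℓ ≤ 163` and only in the weak one-good-prime form (`h67small`).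

So `PastenShimura2024_thm_6_1_b` is proved here (`PastenShimura2024_thm_6_1_b_of_brandtDictionary`)
from: the named facts `mazurKenku_exists_cyclic_isogeny`, `mestreOesterle1989_thm_1`,
`nonempty_shimuraParametrizationData`, `ribet1997_twoPowerFermat`, `darmonMerel1997_denesEquation`,
Mathlib's `FermatLastTheorem`, `mazur_isogeny_irreducible`; and THREE printed inputs as hypotheses,
each one self-contained statement over the tree's vocabulary: (`hDict`) the character-group
dictionary for `X₀^D(M)` at `p ∥ M` (Brandt type `(M/p, Dp)`) — the general-`D`, Shimura-idiom form of
the conjunction `takahashi2001_characterGroupDictionary ∧ takahashi2001_brandtEigenLattice_rank_one`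
(plus the degree-zero containment, as in the parallel seat's `hDict`); (`hT2`) Takahashi's Thm. 2.3
with Thm. 3.2 (a) at `p ∣ D` (verbatim the `hT2` of `…PairwiseTakahashiProofs` /
`…BrandtCoordinatesProofs`); (`h67small`) Lemma 6.7 for `ℓ ≤ 163`, one good prime, for one finite
`S ∋ 2` (verbatim the `h67small` of `…PairwiseEisensteinProofs`; fed by the printed Lemma 6.7 through
its `small_lemma_6_7_of_lemma_6_7`). Compared with `PastenShimura2024_thm_6_1_b_of_takahashi_treeFacts`:
`hTlev` and `hEis` are gone (theorems over `hDict`), `h67` is cut down to `h67small`, at the price of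
the named fact `mazur_isogeny_irreducible`; and in `PastenShimura2024_thm_6_1_b_of_brandtDictionaries`
`hT2` too is derived, from the discriminant-side dictionary `hDictDisc` (Ribet's exact sequence,
Takahashi Prop. 3.1 / Thm. 3.2 (a)), so that all of Takahashi's algebra on both sides is a theorem.

## Contents (sorry-free)

* §I `exists_image_coker_eisenstein_of_brandtData_general` — the engine (item 1).
* §II (section `Dictionary`, hypothesis `hDict`): `levelPackage_of_brandtDictionary` (Thm. 2.3 and
  `i ∣ 12(ℓ + 1 − a_ℓ)` at `p ∥ M`, every `D`), `thm_2_3_level_of_brandtDictionary` (= `hTlev`),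
  `eisenstein12_of_brandtDictionary` (= `hEis` with the factor `12`, for every solution of the level
  system, by uniqueness), `image_dvd_of_brandtDictionary` (Lemma 6.14's
  "`i_p(D,M) ∣ κ_S`" for any selection `cI` of the level solutions, from item 2),
  `PastenShimura2024_thm_6_1_b_of_brandtDictionary_coordinates` (any selections `cI`, `cJ`).
* §II also: hypothesis `hDictDisc` (the discriminant-side dictionary, `p ∣ D`, type `(pM, D/p)`,
  Ribet's exact sequence) and `thm_2_3_disc_of_brandtDictionary` (= `hT2`, the engine without its
  Eisenstein clause).
* §III `PastenShimura2024_thm_6_1_b_of_brandtDictionary` (inputs `hDict`, `hT2`, `h67small`) and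
  `PastenShimura2024_thm_6_1_b_of_brandtDictionaries` (inputs `hDict`, `hDictDisc`, `h67small`) — the
  trust base after this file (selections by choice, as in `…BrandtCoordinatesProofs` §IV).

## References

* H. Pasten, J. Number Theory 254 (2024) = arXiv:1705.09251: Lemma 6.3 p. 21, Lemma 6.7/6.8 p. 22,
  §6.4 p. 22, Prop. 6.13 and Lemma 6.14 (with proof) p. 23, §6.9 p. 25 (held text, read).
  [PastenShimura2024]
* S. Takahashi, J. Number Theory 90 (2001) 74–88: §2 pp. 77–80 (Lemma 2.2, Thm. 2.3, remark p. 80),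
  Prop. 3.1 and Thm. 3.2 (a) p. 82, §3.2 p. 84 (proof of Thm. 3.8) (held text, read). [Takahashi2001]
* K. A. Ribet, Invent. Math. 100 (1990): Prop. 3.1, Thm. 3.12, Thm. 4.1. [Ribet1990]
* K. Buzzard, Duke Math. J. 87 (1997), Thm. 4.7. [Buzzard1997]
* B. H. Gross, Heights and the special values of L-series (1987), §§1–2. [Gross1987]
* B. Mazur, Invent. Math. 44 (1978), Thm. 1. [Mazur1978]
* K. A. Ribet, S. Takahashi, PNAS 94 (1997), Prop. 1–3, Thm. 2 (not held; cited through Pasten and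
  Takahashi). [RibetTakahashi1997]

## Mathlib / tree search

Reused (tree): `Takahashi2001.exists_index_formula`, `Takahashi2001.exists_eq_span_of_finrank_eq_one`,
`Takahashi2001.exists_dual_apply_eq_one_of_eigenLattice_eq`, `xi_lFunction_eq_sum`,
`Brandt.XiSetup.dvd_twelve_mul_sub_of_forall_dvd`, `Brandt.XiSetup.weight_dvd_twelve`,
`exists_dvd_of_eisenstein12_of_mazur`, `prop_6_13_of_takahashi`,
`coker_dvd_of_takahashi`, `IsAdmissibleFactorization.nonempty_xiSetup_level`, `choice_spec_of_exists`,
`choice_pos`, `PastenShimura2024_thm_6_1_b_of_ribetTakahashi_mestreOesterle_fermatQuartic`,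
`ShimuraParametrizationData.IsMinimalFor.deg_dvd_modularDegree`, `lemma_6_8_factorization_form`,
`IsFreyHellegouarch.ordCompl_two_minimalDiscriminantNorm_ne_pow_of_three_le`. Mathlib:
`Finset.sum_pos'`, `Submodule.mem_span_singleton`, `LinearMap.mk₂`.
-/

noncomputable section

open scoped MatrixGroups ModularForm BigOperators

namespace Literature.NumberTheory.Automorphic

open Literature.NumberTheory.EllipticCurves (mazurKenku_exists_cyclic_isogeny
  mestreOesterle1989_thm_1 mazur_isogeny_irreducible LFunction_eq_of_isIsogenous_holds
  xi_lFunction_eq_sum)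
open Literature.NumberTheory.EllipticCurves.Takahashi2001 (exists_index_formula
  exists_eq_span_of_finrank_eq_one exists_dual_apply_eq_one_of_eigenLattice_eq)
open Literature.NumberTheory.EllipticCurves.ModularForms (ModularParametrizationData IsNewformOf
  PastenShimura2024_lemma_6_8_of_mazurKenku')
open Literature.NumberTheory.DiophantineGeometry (ribet1997_twoPowerFermat
  darmonMerel1997_denesEquation)

/-! ## I. The engine: Thm. 2.3 and `i ∣ 12 (ℓ + 1 − a_ℓ)` from Brandt data of any type -/

/-- **Takahashi 2001, Thm. 2.3, with the Eisenstein divisibility, from Brandt data of any type and an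
abstract degree.** Let `S` be a Brandt setup of type `(N⁺, N⁻)`, `W/ℚ` an elliptic curve (supplying
the eigenvalues `a_n = W.LFunction n`), `δ ≥ 1` and `c` naturals, and suppose given inside `ℤ^{Cls O}`:
a saturated sublattice `Y` (the character group); maps
`pb = π^* : ℤ → Y`, `pf = π_* : Y → ℤ` adjoint for Gross's pairing `Σ_c w_c x_c y_c` and
`u(a, b) = c a b`, with `π_* π^* = δ` and `π_*` onto; and the `a(W)`-eigen-lattice of the Brandt
matrices of rank one containing `π^* 1`. Then there are `i, j` with `0 < i`, `i j = c`, `i ∣ ξ_S`,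
`δ i = ξ_S j` (Takahashi's `(i, j) = (#image, #coker)` of `π_*` on component groups, Lemma 2.2 and
Thm. 2.3 via the tree's `exists_index_formula`; the degree-zero containment is not used for this)
AND, if `Y` contains the degree-zero vectors, `i ∣ 12 (ℓ + 1 − a_ℓ(W))` for every prime `ℓ ∤ N⁺N⁻`
(`i` generates `{⟨g, y⟩ : y ∈ Y} ∋ w_c g_c − w_{c'} g_{c'}`, then
`Brandt.XiSetup.dvd_twelve_mul_sub_of_forall_dvd`). This is the parallel seat's
`exists_image_coker_eisenstein_of_brandtData` (type `(M, r)`, `δ = P.modularDegree`) for general type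
and degree; `c > 0` is derived here: `π^* 1 = j g` with `j ≠ 0` (as `π_* π^* 1 = δ ≠ 0`) and
`j ⟨g, g⟩ = ⟨π^* 1, g⟩ = c · π_* g` with `⟨g, g⟩ = Σ w_c g_c² > 0` (`w_c ∣ 12`, so `w_c ≥ 1`).
[cite: Takahashi2001, Lemma 2.2 and Thm. 2.3 (p. 79), p. 84] [cite: Ribet1990, Prop. 3.1 and Thm. 3.12] [cite: PastenShimura2024, Lemma 6.14 p. 23 (proof)] -/
theorem exists_image_coker_eisenstein_of_brandtData_general {Nplus Nminus : ℕ}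
    (W : WeierstrassCurve ℚ) [W.IsElliptic] (S : Brandt.XiSetup Nplus Nminus)
    [Fintype (Brandt.ClassSet S.O)] {δ c : ℕ} (hδ0 : 0 < δ)
    (Y : Submodule ℤ (Brandt.ClassSet S.O → ℤ)) (pb : ℤ →ₗ[ℤ] Y) (pf : Y →ₗ[ℤ] ℤ)
    (hadj : ∀ (a : ℤ) (y : Y),
      ∑ i, (Brandt.weight S.O i : ℤ) * (pb a : Brandt.ClassSet S.O → ℤ) i *
          (y : Brandt.ClassSet S.O → ℤ) i = (c : ℤ) * a * pf y)
    (hδ : ∀ a : ℤ, pf (pb a) = (δ : ℤ) * a) (hsurj : Function.Surjective pf)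
    (hYsat : ∀ (k : ℤ) (v : Brandt.ClassSet S.O → ℤ), k ≠ 0 → k • v ∈ Y → v ∈ Y)
    (hrank : Module.finrank ℤ
      (Brandt.eigenLattice (Nplus * Nminus) (Brandt.matrix S.O) (fun n => W.LFunction n)) = 1)
    (hmem : (pb 1 : Brandt.ClassSet S.O → ℤ) ∈
      Brandt.eigenLattice (Nplus * Nminus) (Brandt.matrix S.O) (fun n => W.LFunction n)) :
    ∃ i j : ℕ, 0 < i ∧ i * j = c ∧ i ∣ S.xi (fun n => W.LFunction n) ∧
      δ * i = S.xi (fun n => W.LFunction n) * j ∧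
      ((∀ v : Brandt.ClassSet S.O → ℤ, ∑ i, v i = 0 → v ∈ Y) →
        ∀ ℓ : ℕ, ℓ.Prime → ¬ ℓ ∣ Nplus * Nminus →
          (i : ℤ) ∣ 12 * ((ℓ + 1 : ℤ) - W.LFunction ℓ)) := by
  classical
  -- the generator `g₀` of the eigen-line; `π^* 1 = j g₀`, `j ≠ 0`, `g₀ ∈ Y`
  obtain ⟨g₀, hg₀, hL⟩ := exists_eq_span_of_finrank_eq_one hrank
  have hg₀mem : g₀ ∈ Brandt.eigenLattice (Nplus * Nminus) (Brandt.matrix S.O)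
      (fun n => W.LFunction n) := by
    rw [hL]; exact Submodule.mem_span_singleton_self g₀
  rw [hL] at hmem
  obtain ⟨j, hj⟩ := Submodule.mem_span_singleton.mp hmem
  have hj0 : j ≠ 0 := by
    rintro rfl
    have h0 : pb 1 = 0 := Subtype.ext (by rw [← hj, zero_smul]; rfl)
    have h1 := hδ 1
    rw [h0, map_zero, mul_one] at h1
    exact hδ0.ne' (by exact_mod_cast h1.symm)
  have hg₀Y : g₀ ∈ Y := hYsat j g₀ hj0 (by rw [hj]; exact (pb 1).2)
  obtain ⟨g, rfl⟩ : ∃ g : Y, (g : Brandt.ClassSet S.O → ℤ) = g₀ := ⟨⟨g₀, hg₀Y⟩, rfl⟩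
  have hg : pb 1 = j • g := Subtype.ext (by rw [Submodule.coe_smul]; exact hj.symm)
  -- `c > 0`: `j ⟨g, g⟩ = ⟨π^* 1, g⟩ = c · π_* g` with `⟨g, g⟩ > 0` and `j ≠ 0`
  have hw : ∀ i : Brandt.ClassSet S.O, 0 < (Brandt.weight S.O i : ℤ) := fun i => by
    exact_mod_cast Nat.pos_of_dvd_of_pos (S.weight_dvd_twelve i) (by norm_num)
  have hgg : 0 < ∑ i, (Brandt.weight S.O i : ℤ) * (g : Brandt.ClassSet S.O → ℤ) i *
      (g : Brandt.ClassSet S.O → ℤ) i := by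
    obtain ⟨i₀, hi₀⟩ : ∃ i, (g : Brandt.ClassSet S.O → ℤ) i ≠ 0 := by
      by_contra h
      push Not at h
      exact hg₀ (funext h)
    refine Finset.sum_pos' (fun i _ => ?_) ⟨i₀, Finset.mem_univ _, ?_⟩
    · rw [mul_assoc]
      exact mul_nonneg (hw i).le (mul_self_nonneg _)
    · rw [mul_assoc]
      exact mul_pos (hw i₀) (mul_self_pos.mpr hi₀)
  have hc0 : 0 < c := by
    by_contra hc
    have hc' : c = 0 := by omega
    have h := hadj 1 g
    rw [hg, Submodule.coe_smul, hc', Nat.cast_zero, zero_mul, zero_mul] at h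
    have h' : j * ∑ i, (Brandt.weight S.O i : ℤ) * (g : Brandt.ClassSet S.O → ℤ) i *
        (g : Brandt.ClassSet S.O → ℤ) i = 0 := by
      rw [Finset.mul_sum, ← h]
      exact Finset.sum_congr rfl fun i _ => by simp only [Pi.smul_apply, smul_eq_mul]; ring
    rcases mul_eq_zero.mp h' with h1 | h1
    · exact hj0 h1
    · exact hgg.ne' h1
  -- Gross's pairing on `ℤ^{Cls O}` and its restriction `u_J` to `Y`; `u_E(a, b) = c a b` on `ℤ`
  let B : (Brandt.ClassSet S.O → ℤ) →ₗ[ℤ] (Brandt.ClassSet S.O → ℤ) →ₗ[ℤ] ℤ :=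
    LinearMap.mk₂ ℤ (fun x y => ∑ i, (Brandt.weight S.O i : ℤ) * x i * y i)
      (fun x₁ x₂ y => by
        simp only [Pi.add_apply, mul_add, add_mul, Finset.sum_add_distrib])
      (fun a x y => by
        simp only [Pi.smul_apply, smul_eq_mul, Finset.mul_sum]
        exact Finset.sum_congr rfl fun i _ => by ring)
      (fun x y₁ y₂ => by
        simp only [Pi.add_apply, mul_add, Finset.sum_add_distrib])
      (fun a x y => by
        simp only [Pi.smul_apply, smul_eq_mul, Finset.mul_sum]
        exact Finset.sum_congr rfl fun i _ => by ring)
  have hB : ∀ x y : Brandt.ClassSet S.O → ℤ, B x y = ∑ i, (Brandt.weight S.O i : ℤ) * x i * y i :=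
    fun x y => rfl
  let uJ : Y →ₗ[ℤ] Y →ₗ[ℤ] ℤ := B.compl₁₂ Y.subtype Y.subtype
  have huJ : ∀ x y : Y, uJ x y = ∑ i, (Brandt.weight S.O i : ℤ) * (x : Brandt.ClassSet S.O → ℤ) i *
      (y : Brandt.ClassSet S.O → ℤ) i := fun x y => by
    simp only [uJ, LinearMap.compl₁₂_apply, Submodule.coe_subtype, hB]
  let uE : ℤ →ₗ[ℤ] ℤ →ₗ[ℤ] ℤ :=
    LinearMap.mk₂ ℤ (fun a b => (c : ℤ) * a * b) (fun a₁ a₂ b => by ring)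
      (fun m a b => by simp only [smul_eq_mul]; ring) (fun a b₁ b₂ => by ring)
      (fun m a b => by simp only [smul_eq_mul]; ring)
  have huE : ∀ a b : ℤ, uE a b = (c : ℤ) * a * b := fun a b => rfl
  -- the hypotheses of the abstract theorem
  have hadj' : ∀ (a : ℤ) (y : Y), uJ (pb a) y = uE a (pf y) := fun a y => by
    rw [huJ, huE, ← hadj a y]
  have hδ' : ∀ a : ℤ, pf (pb a) = (δ : ℤ) • a := fun a => by rw [hδ a, smul_eq_mul]
  have hgen : ∀ x : ℤ, ∃ m : ℤ, m • (1 : ℤ) = x := fun x => ⟨x, by rw [smul_eq_mul, mul_one]⟩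
  have hc' : 0 < uE 1 1 := by rw [huE, mul_one, mul_one]; exact_mod_cast hc0
  have hc'' : uE 1 1 = (c : ℤ) := by rw [huE, mul_one, mul_one]
  -- Lemma 2.2 / Thm. 2.3 with the ideal `(i) = {u_J(g, y)}` kept
  obtain ⟨i, hi, hI, hij, hih, hδi⟩ := exists_index_formula uJ uE pb pf hadj' hδ' hsurj hgen hc' hg
  -- `h = u_J(g, g) = S.xi`
  have hxi : S.xi (fun n => W.LFunction n) =
      ∑ i, Brandt.weight S.O i * ((g : Brandt.ClassSet S.O → ℤ) i).natAbs ^ 2 :=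
    xi_lFunction_eq_sum W S hg₀ hL
  have hh : uJ g g = (S.xi (fun n => W.LFunction n) : ℤ) := by
    rw [hxi, huJ, Nat.cast_sum]
    exact Finset.sum_congr rfl fun i _ => by push_cast; rw [sq_abs]; ring
  -- the Eisenstein divisibility (when `Y ∋` the degree-zero vectors):
  -- `i ∣ u_J(g, e_c − e_{c'}) = w_c g_c − w_{c'} g_{c'}`
  have hcong : (∀ v : Brandt.ClassSet S.O → ℤ, ∑ i, v i = 0 → v ∈ Y) →
      ∀ c₁ c₂ : Brandt.ClassSet S.O,
      (i : ℤ) ∣ (Brandt.weight S.O c₁ : ℤ) * (g : Brandt.ClassSet S.O → ℤ) c₁ -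
        (Brandt.weight S.O c₂ : ℤ) * (g : Brandt.ClassSet S.O → ℤ) c₂ := by
    intro hY0 c₁ c₂
    set y : Brandt.ClassSet S.O → ℤ := Pi.single c₁ 1 - Pi.single c₂ 1 with hy_def
    have hysum : ∑ i, y i = 0 := by
      simp only [hy_def, Pi.sub_apply, Pi.single_apply, Finset.sum_sub_distrib, Finset.sum_ite_eq',
        Finset.mem_univ, if_true, sub_self]
    have hyY : y ∈ Y := hY0 y hysum
    have hmemI : uJ g ⟨y, hyY⟩ ∈ LinearMap.range (uJ g) := LinearMap.mem_range_self _ _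
    rw [hI, Ideal.mem_span_singleton] at hmemI
    have heq : uJ g ⟨y, hyY⟩ =
        (Brandt.weight S.O c₁ : ℤ) * (g : Brandt.ClassSet S.O → ℤ) c₁ -
          (Brandt.weight S.O c₂ : ℤ) * (g : Brandt.ClassSet S.O → ℤ) c₂ := by
      rw [huJ]
      simp only [hy_def, Pi.sub_apply, Pi.single_apply, mul_sub, mul_ite, mul_one, mul_zero,
        Finset.sum_sub_distrib, Finset.sum_ite_eq', Finset.mem_univ, if_true]
    rwa [heq] at hmemI
  have heis : (∀ v : Brandt.ClassSet S.O → ℤ, ∑ i, v i = 0 → v ∈ Y) →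
      ∀ ℓ : ℕ, ℓ.Prime → ¬ ℓ ∣ Nplus * Nminus →
        (i : ℤ) ∣ 12 * ((ℓ + 1 : ℤ) - W.LFunction ℓ) := by
    intro hY0 ℓ hℓ hℓN
    have h := S.dvd_twelve_mul_sub_of_forall_dvd hg₀mem
      (exists_dual_apply_eq_one_of_eigenLattice_eq hg₀ hL) (hcong hY0) hℓ hℓN
    have e : (12 : ℤ) * ((ℓ + 1 : ℤ) - W.LFunction ℓ) = -(12 * (W.LFunction ℓ - (ℓ + 1))) := by ring
    rw [e]
    exact dvd_neg.mpr h
  refine ⟨i, j.natAbs, hi, ?_, ?_, ?_, heis⟩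
  · have h1 : ((i * j.natAbs : ℕ) : ℤ) = (c : ℤ) := by
      rw [Nat.cast_mul, Int.natCast_natAbs, hij, hc'']
    exact_mod_cast h1
  · rw [hh] at hih
    exact_mod_cast hih
  · have h1 : ((δ * i : ℕ) : ℤ) = ((S.xi (fun n => W.LFunction n) * j.natAbs : ℕ) : ℤ) := by
      rw [Nat.cast_mul, Nat.cast_mul, Int.natCast_natAbs, hδi, hh]
    exact_mod_cast h1

/-! ## II. The level side over the character-group dictionary -/

section Dictionary

variable
  /- (`hDict`) **The character-group dictionary for `X₀^D(M)` at a prime `p ∥ M` (level side).**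
  Takahashi 2001 §2 p. 78 and p. 84 (Buzzard 1997 Thm. 4.7; `D = 1`: Ribet 1990 Prop. 3.1,
  Deligne–Rapoport), SGA 7 IX 11.5, multiplicity one: for `N = DM` admissible, `M = p m` with `p ∤ m`,
  `W/ℚ` of conductor `N`, `P` minimal for `W` on `X : ShimuraCurveData D M` (the optimal quotient
  `q_{D,M} : J₀^D(M) → A_{D,M} ≅ W'`, `P.deg = δ_{D,M}`), and every Brandt setup `S` of type `(m, Dp)`
  (definite quaternion algebra of discriminant `Dp`, Eichler order of level `m`): inside `ℤ^{Cls O}`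
  there are a sublattice `Y` (the character group `X_p(J₀^D(M)) ≅ ℤ[Cls O]⁰`, compatibly with `T_n`,
  `(n, N) = 1`, and with the monodromy pairing `⟨e_c, e_{c'}⟩ = w_c δ_{cc'}`) and `ℤ`-linear
  `pb : ℤ → Y` (`q^*` on `X_p(A) ≅ ℤ`, multiplicative reduction at `p`), `pf : Y → ℤ` (`q_*`) with:
  `u_J(q^* a, y) = c_p(A) · a · q_*(y)`, `c_p(A) = #Φ_p(A) = ord_p Δ_min(W')` (adjunction for
  Grothendieck's pairing; Pasten p. 22); `q_* q^* = δ_{D,M} = P.deg`; `q_*` onto (optimality); `Y`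
  saturated; `Y ∋` every `v` with `Σ_c v_c = 0`; the `a(W')`-eigen-lattice of the Brandt matrices has
  rank one ("`L_p(J)` is free of rank one", p. 78) and contains `q^* 1` ("the image of `q^*` lies in
  `L_p(J)`", p. 78). At `D = 1` in the classical idiom this is the parallel seat's `hDict`
  (`…PairwiseEisensteinProofs`), i.e. the tree's facts `takahashi2001_characterGroupDictionary ∧
  takahashi2001_brandtEigenLattice_rank_one` at `r ∥ N` with the degree-zero containment. -/
  (hDict : ∀ {N D M p m : ℕ}, p.Prime → M = p * m → ¬ p ∣ m → IsAdmissibleFactorization N D M →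
    ∀ (X : ShimuraCurveData D M) (W : WeierstrassCurve ℚ) [W.IsElliptic], W.conductorNorm ℤ = N →
    ∀ (W' : WeierstrassCurve ℚ) [W'.IsElliptic] (P : ShimuraParametrizationData X W'),
      P.IsMinimalFor W →
    ∀ (S : Brandt.XiSetup m (D * p)) [Fintype (Brandt.ClassSet S.O)],
      ∃ (Y : Submodule ℤ (Brandt.ClassSet S.O → ℤ)) (pb : ℤ →ₗ[ℤ] Y) (pf : Y →ₗ[ℤ] ℤ),
        (∀ (a : ℤ) (y : Y),
            ∑ i, (Brandt.weight S.O i : ℤ) * (pb a : Brandt.ClassSet S.O → ℤ) i *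
                (y : Brandt.ClassSet S.O → ℤ) i =
              ((W'.minimalDiscriminantNorm ℤ).factorization p : ℤ) * a * pf y) ∧
        (∀ a : ℤ, pf (pb a) = (P.deg : ℤ) * a) ∧
        Function.Surjective pf ∧
        (∀ (k : ℤ) (v : Brandt.ClassSet S.O → ℤ), k ≠ 0 → k • v ∈ Y → v ∈ Y) ∧
        (∀ v : Brandt.ClassSet S.O → ℤ, ∑ i, v i = 0 → v ∈ Y) ∧
        Module.finrank ℤ
            (Brandt.eigenLattice (m * (D * p)) (Brandt.matrix S.O) (fun n => W'.LFunction n)) = 1 ∧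
        (pb 1 : Brandt.ClassSet S.O → ℤ) ∈
          Brandt.eigenLattice (m * (D * p)) (Brandt.matrix S.O) (fun n => W'.LFunction n))

include hDict in
/-- **The level package from the dictionary**: for `N = DM` admissible, `p ∥ M` (`M = p m`), `P`
minimal for a curve of conductor `N` on `X₀^D(M)` and every Brandt setup `S` of type `(m, Dp)`:
Takahashi's `(i_p, j_p)` — `0 < i`, `i j = c_p(W')`, `i ∣ ξ_S`, `δ_{D,M} i = ξ_S j` — and
`i ∣ 12 (ℓ + 1 − a_ℓ(W'))` for every prime `ℓ ∤ N` (the engine of §I at type `(m, Dp)`,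
`m · Dp = N`). [cite: Takahashi2001, Thm. 2.3 (p. 79), p. 84] [cite: PastenShimura2024, Lemma 6.14 p. 23 (proof)] -/
theorem levelPackage_of_brandtDictionary {N D M p m : ℕ} (hp : p.Prime) (hM : M = p * m)
    (hpm : ¬ p ∣ m) (hadm : IsAdmissibleFactorization N D M) (X : ShimuraCurveData D M)
    (W : WeierstrassCurve ℚ) [W.IsElliptic] (hWN : W.conductorNorm ℤ = N) (W' : WeierstrassCurve ℚ)
    [W'.IsElliptic] (P : ShimuraParametrizationData X W') (hP : P.IsMinimalFor W)
    (S : Brandt.XiSetup m (D * p)) :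
    ∃ i j : ℕ, 0 < i ∧ i * j = (W'.minimalDiscriminantNorm ℤ).factorization p ∧
      i ∣ S.xi (fun n => W'.LFunction n) ∧ P.deg * i = S.xi (fun n => W'.LFunction n) * j ∧
      ∀ ℓ : ℕ, ℓ.Prime → ¬ ℓ ∣ N → (i : ℤ) ∣ 12 * ((ℓ + 1 : ℤ) - W'.LFunction ℓ) := by
  classical
  letI : Fintype (Brandt.ClassSet S.O) := Fintype.ofFinite _
  obtain ⟨Y, pb, pf, hadj, hδ, hsurj, hYsat, hY0, hrank, hmem⟩ :=
    hDict hp hM hpm hadm X W hWN W' P hP S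
  obtain ⟨i, j, hi, hij, hiξ, hδi, heis⟩ := exists_image_coker_eisenstein_of_brandtData_general W' S
    P.deg_pos Y pb pf hadj hδ hsurj hYsat hrank hmem
  have hmN : m * (D * p) = N := by rw [← hadm.mul_eq, hM]; ring
  exact ⟨i, j, hi, hij, hiξ, hδi, fun ℓ hℓ hℓN => heis hY0 ℓ hℓ (by rwa [hmN])⟩

include hDict in
/-- **Takahashi 2001, Thm. 2.3 for `X₀^D(M)` at `p ∥ M` from the dictionary** — exactly the
hypothesis `hTlev` of `ShimuraCurveRibetTakahashiBrandtCoordinatesProofs.lean`.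
[cite: Takahashi2001, Thm. 2.3 (p. 79), remark p. 80, p. 84] -/
theorem thm_2_3_level_of_brandtDictionary {N D M p m : ℕ} (hp : p.Prime) (hM : M = p * m)
    (hpm : ¬ p ∣ m) (hadm : IsAdmissibleFactorization N D M) (X : ShimuraCurveData D M)
    (W : WeierstrassCurve ℚ) [W.IsElliptic] (hWN : W.conductorNorm ℤ = N) (W' : WeierstrassCurve ℚ)
    [W'.IsElliptic] (P : ShimuraParametrizationData X W') (hP : P.IsMinimalFor W)
    (S : Brandt.XiSetup m (D * p)) :
    ∃ i j : ℕ, 0 < i ∧ i * j = (W'.minimalDiscriminantNorm ℤ).factorization p ∧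
      i ∣ S.xi (fun n => W'.LFunction n) ∧ P.deg * i = S.xi (fun n => W'.LFunction n) * j := by
  obtain ⟨i, j, hi, hij, hiξ, hδi, -⟩ :=
    levelPackage_of_brandtDictionary hDict hp hM hpm hadm X W hWN W' P hP S
  exact ⟨i, j, hi, hij, hiξ, hδi⟩

include hDict in
/-- **The Eisenstein divisibility with the factor `12` for every solution of the level system** —
the hypothesis `hEis` of `…BrandtCoordinatesProofs` up to the factor `12`: Thm. 2.3's system
`i j = c_p`, `δ i = ξ j` has exactly one solution (`δ i² = ξ c`; the parallel seat's `unique_image`),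
namely the `(i_p, j_p)` of `levelPackage_of_brandtDictionary`, for which
`i_p ∣ 12 (ℓ + 1 − a_ℓ(W'))`, `ℓ ∤ N` prime.
[cite: PastenShimura2024, Lemma 6.14 p. 23 (proof)] [cite: Ribet1990, Thm. 3.12] -/
theorem eisenstein12_of_brandtDictionary {N D M p m : ℕ} (hp : p.Prime) (hM : M = p * m)
    (hpm : ¬ p ∣ m) (hadm : IsAdmissibleFactorization N D M) (X : ShimuraCurveData D M)
    (W : WeierstrassCurve ℚ) [W.IsElliptic] (hWN : W.conductorNorm ℤ = N) (W' : WeierstrassCurve ℚ)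
    [W'.IsElliptic] (P : ShimuraParametrizationData X W') (hP : P.IsMinimalFor W)
    (S : Brandt.XiSetup m (D * p)) (i j : ℕ) (_hi : 0 < i)
    (hij : i * j = (W'.minimalDiscriminantNorm ℤ).factorization p)
    (hδi : P.deg * i = S.xi (fun n => W'.LFunction n) * j) (ℓ : ℕ) (hℓ : ℓ.Prime)
    (hℓN : ¬ ℓ ∣ N) : (i : ℤ) ∣ 12 * ((ℓ + 1 : ℤ) - W'.LFunction ℓ) := by
  obtain ⟨i₀, j₀, -, hij₀, -, hδi₀, heis⟩ :=
    levelPackage_of_brandtDictionary hDict hp hM hpm hadm X W hWN W' P hP S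
  -- uniqueness: `δ i² = ξ i j = ξ c = δ i₀²`, `δ > 0`
  have hii : i = i₀ := by
    have key : P.deg * (i * i) = P.deg * (i₀ * i₀) :=
      calc P.deg * (i * i) = (P.deg * i) * i := by ring
        _ = S.xi (fun n => W'.LFunction n) * j * i := by rw [hδi]
        _ = S.xi (fun n => W'.LFunction n) * (i * j) := by ring
        _ = S.xi (fun n => W'.LFunction n) * (i₀ * j₀) := by rw [hij, hij₀]
        _ = (S.xi (fun n => W'.LFunction n) * j₀) * i₀ := by ring
        _ = (P.deg * i₀) * i₀ := by rw [hδi₀]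
        _ = P.deg * (i₀ * i₀) := by ring
    exact Nat.mul_self_inj.mp (Nat.eq_of_mul_eq_mul_left P.deg_pos key)
  rw [hii]
  exact heis ℓ hℓ hℓN

variable
  /- (`hDictDisc`) **The character-group dictionary for `X₀^D(M)` at a prime `p ∣ D` (discriminant
  side).** Takahashi 2001 Prop. 3.1 p. 82 (Ribet's exact sequence
  `0 → X_p(J₀^{dpq}(m)) → X_q(J₀^d(pqm)) → X_q(J₀^d(qm))² → 0`, Hecke- and pairing-compatible;
  Ribet 1990 Thm. 4.1 at `d = 1`, = Ribet–Takahashi 1997 Prop. 1, Čerednik–Drinfeld) with p. 84 and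
  §2 p. 78, SGA 7 IX 11.5, multiplicity one: for `N = DM` admissible, `D = p d`, `W/ℚ` of conductor
  `N`, `P` minimal for `W` on `X : ShimuraCurveData D M` (`q : J₀^D(M) → A_{D,M} ≅ W'`,
  `P.deg = δ_{D,M}`) and every Brandt setup `S` of type `(pM, d)`: inside `ℤ^{Cls O}` (the Brandt
  module in which `X_s(J₀^{D/(ps)}(psM))` lives for any prime `s ∣ d`, p. 84) there are a SATURATED
  sublattice `Y` (the image of `X_p(J₀^D(M))` under Ribet's `∂`, an isometric Hecke embedding with
  torsion-free cokernel) and `pb = q^* : ℤ → Y`, `pf = q_* : Y → ℤ` with the adjunction for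
  `c_p(A) = ord_p Δ_min(W')`, `q_* q^* = P.deg`, `q_*` onto, and the `a(W')`-eigen-lattice of the
  Brandt matrices of rank one containing `q^* 1` (Thm. 3.2 (a), proof: "`∂ L_p(J') = L_q(J)` since
  the eigenvalues for both eigenspaces are the Fourier coefficients of `f`"). No degree-zero
  containment is asserted (`Y` is a proper sublattice of `ℤ[Cls O]⁰` in general). -/
  (hDictDisc : ∀ {N D M p d : ℕ}, p.Prime → D = p * d → IsAdmissibleFactorization N D M →
    ∀ (X : ShimuraCurveData D M) (W : WeierstrassCurve ℚ) [W.IsElliptic], W.conductorNorm ℤ = N →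
    ∀ (W' : WeierstrassCurve ℚ) [W'.IsElliptic] (P : ShimuraParametrizationData X W'),
      P.IsMinimalFor W →
    ∀ (S : Brandt.XiSetup (p * M) d) [Fintype (Brandt.ClassSet S.O)],
      ∃ (Y : Submodule ℤ (Brandt.ClassSet S.O → ℤ)) (pb : ℤ →ₗ[ℤ] Y) (pf : Y →ₗ[ℤ] ℤ),
        (∀ (a : ℤ) (y : Y),
            ∑ i, (Brandt.weight S.O i : ℤ) * (pb a : Brandt.ClassSet S.O → ℤ) i *
                (y : Brandt.ClassSet S.O → ℤ) i =
              ((W'.minimalDiscriminantNorm ℤ).factorization p : ℤ) * a * pf y) ∧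
        (∀ a : ℤ, pf (pb a) = (P.deg : ℤ) * a) ∧
        Function.Surjective pf ∧
        (∀ (k : ℤ) (v : Brandt.ClassSet S.O → ℤ), k ≠ 0 → k • v ∈ Y → v ∈ Y) ∧
        Module.finrank ℤ
            (Brandt.eigenLattice (p * M * d) (Brandt.matrix S.O) (fun n => W'.LFunction n)) = 1 ∧
        (pb 1 : Brandt.ClassSet S.O → ℤ) ∈
          Brandt.eigenLattice (p * M * d) (Brandt.matrix S.O) (fun n => W'.LFunction n))

include hDictDisc in
/-- **Takahashi 2001, Thm. 2.3 with Thm. 3.2 (a) for `X₀^D(M)` at `p ∣ D` from the discriminant-side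
dictionary** — exactly the hypothesis `hT2` of `…PairwiseTakahashiProofs` / `…BrandtCoordinatesProofs`
(the engine of §I without its Eisenstein clause). [cite: Takahashi2001, Thm. 2.3 (p. 79), Prop. 3.1 and Thm. 3.2 (a) (p. 82), p. 84] -/
theorem thm_2_3_disc_of_brandtDictionary {N D M p d : ℕ} (hp : p.Prime) (hD : D = p * d)
    (hadm : IsAdmissibleFactorization N D M) (X : ShimuraCurveData D M) (W : WeierstrassCurve ℚ)
    [W.IsElliptic] (hWN : W.conductorNorm ℤ = N) (W' : WeierstrassCurve ℚ) [W'.IsElliptic]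
    (P : ShimuraParametrizationData X W') (hP : P.IsMinimalFor W) (S : Brandt.XiSetup (p * M) d) :
    ∃ i j : ℕ, 0 < i ∧ i * j = (W'.minimalDiscriminantNorm ℤ).factorization p ∧
      i ∣ S.xi (fun n => W'.LFunction n) ∧ P.deg * i = S.xi (fun n => W'.LFunction n) * j := by
  classical
  letI : Fintype (Brandt.ClassSet S.O) := Fintype.ofFinite _
  obtain ⟨Y, pb, pf, hadj, hδ, hsurj, hYsat, hrank, hmem⟩ := hDictDisc hp hD hadm X W hWN W' P hP S
  obtain ⟨i, j, hi, hij, hiξ, hδi, -⟩ := exists_image_coker_eisenstein_of_brandtData_general W' S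
    P.deg_pos Y pb pf hadj hδ hsurj hYsat hrank hmem
  exact ⟨i, j, hi, hij, hiξ, hδi⟩

variable
  (cI cJ : ∀ {D M : ℕ} {X : ShimuraCurveData D M} {W' : WeierstrassCurve ℚ},
    ShimuraParametrizationData X W' → ℕ → ℕ)
  (hcI : ∀ {D M : ℕ} {X : ShimuraCurveData D M} {W' : WeierstrassCurve ℚ}
    (P : ShimuraParametrizationData X W') (p : ℕ),
    (∃ i : ℕ, 0 < i ∧ ∃ j : ℕ, i * j = (W'.minimalDiscriminantNorm ℤ).factorization p ∧
      P.deg * i = brandtXi (M / p) (D * p) (fun n => W'.LFunction n) * j) →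
    0 < cI P p ∧ ∃ j : ℕ, cI P p * j = (W'.minimalDiscriminantNorm ℤ).factorization p ∧
      P.deg * cI P p = brandtXi (M / p) (D * p) (fun n => W'.LFunction n) * j)
  (hcJ : ∀ {D M : ℕ} {X : ShimuraCurveData D M} {W' : WeierstrassCurve ℚ}
    (P : ShimuraParametrizationData X W') (p : ℕ),
    (∃ j : ℕ, 0 < j ∧ ∃ i : ℕ, i * j = (W'.minimalDiscriminantNorm ℤ).factorization p ∧
      P.deg * i = brandtXi (p * M) (D / p) (fun n => W'.LFunction n) * j) →
    0 < cJ P p ∧ ∃ i : ℕ, i * cJ P p = (W'.minimalDiscriminantNorm ℤ).factorization p ∧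
      P.deg * i = brandtXi (p * M) (D / p) (fun n => W'.LFunction n) * cJ P p)

include hDict hcI in
/-- **Pasten 2024, Lemma 6.14 ("`i_p(D,M) ∣ κ_S`") for a selection `cI` of the level solutions, with
its large primes from Mazur's theorem.** Given Mazur's Theorem 1 (`mazur_isogeny_irreducible`) and
Lemma 6.7 for the primes `ℓ ≤ 163` in the one-good-prime form (`h67small`): one `κ₁ ≥ 1` supported on
primes `≤ 163` such that for `N = DM` admissible and squarefree away from `S`, `W` of conductor `N`,
`P` minimal for `W` on `X₀^D(M)` and `p ∥ M`: `cI P p ∣ κ₁`. Proof: `cI P p` solves the level system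
(a solution exists by the dictionary, §II), so `cI P p ∣ 12 (ℓ + 1 − a_ℓ(W'))` for `ℓ ∤ N`
(`eisenstein12_of_brandtDictionary`), `a_ℓ(W') = a_ℓ(W)` (isogeny invariance), and the parallel
seat's `exists_dvd_of_eisenstein12_of_mazur` applied to `A = W`. This is the hypothesis `h614` of
`PastenShimura2024_thm_6_1_b_of_ribetTakahashi_mestreOesterle_fermatQuartic`.
[cite: PastenShimura2024, Lemma 6.14 p. 23 (statement and proof), Lemma 6.3 p. 21, Lemma 6.7 p. 22] [cite: Mazur1978, Thm. 1] -/
theorem image_dvd_of_brandtDictionary (hMaz : mazur_isogeny_irreducible) {S : Finset ℕ}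
    (h67small : ∀ ℓ : ℕ, ℓ.Prime → ℓ ≤ 163 → ∃ β : ℕ,
      ∀ (A : WeierstrassCurve ℚ) [A.IsElliptic],
        (∀ q : ℕ, q.Prime → q ∉ S → ¬ q ^ 2 ∣ A.conductorNorm ℤ) →
        ∃ r : ℕ, r.Prime ∧ ¬ r ∣ A.conductorNorm ℤ ∧
          ¬ ((ℓ ^ β : ℕ) : ℤ) ∣ (r + 1 : ℤ) - A.LFunction r) :
    ∃ κ₁ : ℕ, 0 < κ₁ ∧ (∀ q ∈ κ₁.primeFactors, q ≤ 163) ∧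
      ∀ {N D M : ℕ}, IsAdmissibleFactorization N D M →
      ∀ (X : ShimuraCurveData D M) (W : WeierstrassCurve ℚ) [W.IsElliptic] [W.IsGloballyMinimal],
        W.conductorNorm ℤ = N → (∀ q : ℕ, q.Prime → q ∉ S → ¬ q ^ 2 ∣ N) →
      ∀ (W' : WeierstrassCurve ℚ) [W'.IsElliptic] (P : ShimuraParametrizationData X W'),
        P.IsMinimalFor W → ∀ p : ℕ, p.Prime → p ∣ M → ¬ p ^ 2 ∣ M → cI P p ∣ κ₁ := by
  obtain ⟨κ₁, hκ₁, hκ₁', h⟩ := exists_dvd_of_eisenstein12_of_mazur hMaz h67small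
  refine ⟨κ₁, hκ₁, hκ₁', ?_⟩
  intro N D M hadm X W _ _ hWN hSq W' _ P hP p hp hpM hp2
  obtain ⟨m, hM⟩ := hpM
  have hpm : ¬ p ∣ m := fun h1 => hp2 (by rw [hM, sq]; exact Nat.mul_dvd_mul_left p h1)
  obtain ⟨T⟩ := hadm.nonempty_xiSetup_level hp hM hpm
  -- `cI P p` solves the level system
  obtain ⟨i, j, hi, hij, -, hδi, -⟩ :=
    levelPackage_of_brandtDictionary hDict hp hM hpm hadm X W hWN W' P hP T
  rw [← T.brandtXi_eq_xi] at hδi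
  have hdiv : M / p = m := by rw [hM]; exact Nat.mul_div_cancel_left _ hp.pos
  obtain ⟨hI, j', hc', hδ'⟩ := hcI P p ⟨i, hi, j, hij, by rw [hdiv]; exact hδi⟩
  rw [hdiv, T.brandtXi_eq_xi] at hδ'
  have heis := eisenstein12_of_brandtDictionary hDict hp hM hpm hadm X W hWN W' P hP T (cI P p) j'
    hI hc' hδ'
  -- `a_ℓ(W') = a_ℓ(W)`, and Lemma 6.14 (factor `12`) applied to `A = W`
  have hL : W'.LFunction = W.LFunction := (LFunction_eq_of_isIsogenous_holds W W' hP.1).symm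
  exact h W hadm.pos hWN hSq hI fun r hr hrN => by
    have h1 := heis r hr hrN
    rw [hL] at h1
    exact_mod_cast h1

include hDict hcI hcJ in
/-- **Pasten 2024, Thm. 6.1 (b) from the dictionary, any selections `cI`, `cJ`.** The tree's
`PastenShimura2024_thm_6_1_b_of_ribetTakahashi_mestreOesterle_fermatQuartic` fed with: Prop. 6.13 for
every `d` (`prop_6_13_of_takahashi`, with `hTlev` := `thm_2_3_level_of_brandtDictionary`, and `hT2`);
`j_p ∣ c_p` (`coker_dvd_of_takahashi`); Lemma 6.8 from Mazur–Kenku; Lemma 6.14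
(`image_dvd_of_brandtDictionary`, from `hDict`, Mazur's theorem and `h67small`); Mestre–Oesterlé;
the `D = 1` bridge (`IsMinimalFor.deg_dvd_modularDegree`); Lemma 6.12 for `ℓ ≥ 3` (Euler–Legendre at
`ℓ = 3`, Wiles + Ribet + Darmon–Merel for `ℓ ≥ 5`).
[cite: PastenShimura2024, Thm. 6.1 (b) p. 20, §6.3–6.9 pp. 21–25] [cite: Takahashi2001, Thm. 2.3 (p. 79), Thm. 3.2 (a) (p. 82), p. 84] -/
theorem PastenShimura2024_thm_6_1_b_of_brandtDictionary_coordinates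
    (hMK : mazurKenku_exists_cyclic_isogeny) (hMO : mestreOesterle1989_thm_1)
    (hP : nonempty_shimuraParametrizationData)
    (hRib : ribet1997_twoPowerFermat) (hDM : darmonMerel1997_denesEquation)
    (hFLT : FermatLastTheorem) (hMaz : mazur_isogeny_irreducible)
    (hT2 : ∀ {N D M p d : ℕ}, p.Prime → D = p * d → IsAdmissibleFactorization N D M →
      ∀ (X : ShimuraCurveData D M) (W : WeierstrassCurve ℚ) [W.IsElliptic],
        W.conductorNorm ℤ = N →
      ∀ (W' : WeierstrassCurve ℚ) [W'.IsElliptic] (P : ShimuraParametrizationData X W'),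
        P.IsMinimalFor W →
      ∀ S : Brandt.XiSetup (p * M) d,
        ∃ i j : ℕ, 0 < i ∧ i * j = (W'.minimalDiscriminantNorm ℤ).factorization p ∧
          i ∣ S.xi (fun n => W'.LFunction n) ∧
          P.deg * i = S.xi (fun n => W'.LFunction n) * j)
    (hI : ∀ {D M : ℕ} {X : ShimuraCurveData D M} {W' : WeierstrassCurve ℚ}
      (P : ShimuraParametrizationData X W') (p : ℕ), 0 < cI P p)
    (hJ : ∀ {D M : ℕ} {X : ShimuraCurveData D M} {W' : WeierstrassCurve ℚ}
      (P : ShimuraParametrizationData X W') (p : ℕ), 0 < cJ P p)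
    {S : Finset ℕ} (h2S : 2 ∈ S)
    (h67small : ∀ ℓ : ℕ, ℓ.Prime → ℓ ≤ 163 → ∃ β : ℕ,
      ∀ (A : WeierstrassCurve ℚ) [A.IsElliptic],
        (∀ q : ℕ, q.Prime → q ∉ S → ¬ q ^ 2 ∣ A.conductorNorm ℤ) →
        ∃ r : ℕ, r.Prime ∧ ¬ r ∣ A.conductorNorm ℤ ∧
          ¬ ((ℓ ^ β : ℕ) : ℤ) ∣ (r + 1 : ℤ) - A.LFunction r) :
    PastenShimura2024_thm_6_1_b := by
  obtain ⟨κ₁, hκ₁, hκ₁', h614⟩ := image_dvd_of_brandtDictionary hDict cI hcI hMaz h67small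
  refine PastenShimura2024_thm_6_1_b_of_ribetTakahashi_mestreOesterle_fermatQuartic cI cJ hI hJ
    (fun hp hr hpr hD hM₁ hadm X₁ X₂ W _ _ hWN W₁' _ P₁ hP₁ W₂' _ P₂ hP₂ =>
      prop_6_13_of_takahashi
        (fun hp hM hpm hadm X W _ hWN W' _ P hP S =>
          thm_2_3_level_of_brandtDictionary hDict hp hM hpm hadm X W hWN W' P hP S)
        hT2 cI cJ hcI hcJ hp hr hpr hD hM₁ hadm X₁ X₂ W hWN W₁' P₁ hP₁ W₂' P₂ hP₂)
    (fun hadm X W _ _ hWN W' _ P hP p hp hpD =>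
      coker_dvd_of_takahashi hT2 cJ hcJ hadm X W hWN W' P hP p hp hpD)
    (fun W W' _ _ hiso p hp hpN hp2 =>
      lemma_6_8_factorization_form (PastenShimura2024_lemma_6_8_of_mazurKenku' hMK) W W' hiso p hp
        hpN hp2)
    hκ₁ h614 hMO hP
    (fun _X _W _ _ _hN _hcl _W₁ _ D₁ hf hmin _W' _ _P hP => hP.deg_dvd_modularDegree D₁ hf hmin)
    hκ₁' h2S ?_
  -- Lemma 6.12 for `ℓ ≥ 3`
  intro W _ hFH hodd ℓ hℓ h3 k
  exact IsFreyHellegouarch.ordCompl_two_minimalDiscriminantNorm_ne_pow_of_three_le hRib hDM hℓ h3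
    (hFLT ℓ h3) hFH hodd k

end Dictionary

/-! ## III. Thm. 6.1 (b) over declarations and three printed inputs -/

/-- **Pasten 2024, Thm. 6.1 (b) over the tree's facts and the character-group dictionary — the trust
base after this file.** `PastenShimura2024_thm_6_1_b` from: the named facts
`mazurKenku_exists_cyclic_isogeny` (Lemma 6.8), `mestreOesterle1989_thm_1` (Lemma 6.11),
`nonempty_shimuraParametrizationData` (Jacquet–Langlands: the data at the levels of the telescoping),
`ribet1997_twoPowerFermat`, `darmonMerel1997_denesEquation`, Mathlib's statement `FermatLastTheorem`
(Lemma 6.12 for `ℓ ≥ 5`), `mazur_isogeny_irreducible` (Lemma 6.3: Lemma 6.7 for `ℓ > 163`); and three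
printed inputs, each a single self-contained statement over the tree's vocabulary: (`hDict`) the
character-group dictionary for `X₀^D(M)` at `p ∥ M` (Takahashi 2001 §2 / p. 84 with multiplicity
one; general-`D` Shimura-idiom form of `takahashi2001_characterGroupDictionary ∧
takahashi2001_brandtEigenLattice_rank_one`); (`hT2`) Takahashi's Thm. 2.3 with Thm. 3.2 (a) for
`X₀^D(M)` at `p ∣ D`; (`h67small`) Pasten's Lemma 6.7 for the primes `ℓ ≤ 163`, one good prime, for
one finite `S ∋ 2`. The orders `i_p`, `j_p` of §6.6 are the selections by choice of the unique
solutions of Takahashi's systems; Takahashi's Thm. 2.3 on the level side, Prop. 6.13 for every `d`,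
`j_p ∣ c_p`, the Eisenstein divisibility (factor `12`), Lemma 6.14, Lemmas 6.15–6.17 and §6.9, and
every Diophantine input are theorems. [cite: PastenShimura2024, Thm. 6.1 (b) p. 20, §6.3–6.9 pp. 21–25] [cite: Takahashi2001, §2 p. 78, Thm. 2.3 (p. 79), Prop. 3.1 and Thm. 3.2 (a) (p. 82), p. 84] [cite: Mazur1978, Thm. 1] -/
theorem PastenShimura2024_thm_6_1_b_of_brandtDictionary
    (hMK : mazurKenku_exists_cyclic_isogeny) (hMO : mestreOesterle1989_thm_1)
    (hP : nonempty_shimuraParametrizationData)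
    (hRib : ribet1997_twoPowerFermat) (hDM : darmonMerel1997_denesEquation)
    (hFLT : FermatLastTheorem) (hMaz : mazur_isogeny_irreducible)
    (hDict : ∀ {N D M p m : ℕ}, p.Prime → M = p * m → ¬ p ∣ m → IsAdmissibleFactorization N D M →
      ∀ (X : ShimuraCurveData D M) (W : WeierstrassCurve ℚ) [W.IsElliptic], W.conductorNorm ℤ = N →
      ∀ (W' : WeierstrassCurve ℚ) [W'.IsElliptic] (P : ShimuraParametrizationData X W'),
        P.IsMinimalFor W →
      ∀ (S : Brandt.XiSetup m (D * p)) [Fintype (Brandt.ClassSet S.O)],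
        ∃ (Y : Submodule ℤ (Brandt.ClassSet S.O → ℤ)) (pb : ℤ →ₗ[ℤ] Y) (pf : Y →ₗ[ℤ] ℤ),
          (∀ (a : ℤ) (y : Y),
              ∑ i, (Brandt.weight S.O i : ℤ) * (pb a : Brandt.ClassSet S.O → ℤ) i *
                  (y : Brandt.ClassSet S.O → ℤ) i =
                ((W'.minimalDiscriminantNorm ℤ).factorization p : ℤ) * a * pf y) ∧
          (∀ a : ℤ, pf (pb a) = (P.deg : ℤ) * a) ∧
          Function.Surjective pf ∧
          (∀ (k : ℤ) (v : Brandt.ClassSet S.O → ℤ), k ≠ 0 → k • v ∈ Y → v ∈ Y) ∧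
          (∀ v : Brandt.ClassSet S.O → ℤ, ∑ i, v i = 0 → v ∈ Y) ∧
          Module.finrank ℤ
              (Brandt.eigenLattice (m * (D * p)) (Brandt.matrix S.O) (fun n => W'.LFunction n)) = 1 ∧
          (pb 1 : Brandt.ClassSet S.O → ℤ) ∈
            Brandt.eigenLattice (m * (D * p)) (Brandt.matrix S.O) (fun n => W'.LFunction n))
    (hT2 : ∀ {N D M p d : ℕ}, p.Prime → D = p * d → IsAdmissibleFactorization N D M →
      ∀ (X : ShimuraCurveData D M) (W : WeierstrassCurve ℚ) [W.IsElliptic],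
        W.conductorNorm ℤ = N →
      ∀ (W' : WeierstrassCurve ℚ) [W'.IsElliptic] (P : ShimuraParametrizationData X W'),
        P.IsMinimalFor W →
      ∀ S : Brandt.XiSetup (p * M) d,
        ∃ i j : ℕ, 0 < i ∧ i * j = (W'.minimalDiscriminantNorm ℤ).factorization p ∧
          i ∣ S.xi (fun n => W'.LFunction n) ∧
          P.deg * i = S.xi (fun n => W'.LFunction n) * j)
    {S : Finset ℕ} (h2S : 2 ∈ S)
    (h67small : ∀ ℓ : ℕ, ℓ.Prime → ℓ ≤ 163 → ∃ β : ℕ,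
      ∀ (A : WeierstrassCurve ℚ) [A.IsElliptic],
        (∀ q : ℕ, q.Prime → q ∉ S → ¬ q ^ 2 ∣ A.conductorNorm ℤ) →
        ∃ r : ℕ, r.Prime ∧ ¬ r ∣ A.conductorNorm ℤ ∧
          ¬ ((ℓ ^ β : ℕ) : ℤ) ∣ (r + 1 : ℤ) - A.LFunction r) :
    PastenShimura2024_thm_6_1_b := by
  classical
  exact PastenShimura2024_thm_6_1_b_of_brandtDictionary_coordinates hDict
    (fun {D M} {_X} {W'} P p =>
      if h : ∃ i : ℕ, 0 < i ∧ ∃ j : ℕ, i * j = (W'.minimalDiscriminantNorm ℤ).factorization p ∧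
          P.deg * i = brandtXi (M / p) (D * p) (fun n => W'.LFunction n) * j
      then Classical.choose h else 1)
    (fun {D M} {_X} {W'} P p =>
      if h : ∃ j : ℕ, 0 < j ∧ ∃ i : ℕ, i * j = (W'.minimalDiscriminantNorm ℤ).factorization p ∧
          P.deg * i = brandtXi (p * M) (D / p) (fun n => W'.LFunction n) * j
      then Classical.choose h else 1)
    (fun P p hex => choice_spec_of_exists _ hex) (fun P p hex => choice_spec_of_exists _ hex)
    hMK hMO hP hRib hDM hFLT hMaz hT2
    (fun P p => choice_pos _ fun i hi => hi.1) (fun P p => choice_pos _ fun j hj => hj.1)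
    h2S h67small

/-- **Pasten 2024, Thm. 6.1 (b) over the tree's facts and the two character-group dictionaries.**
As `PastenShimura2024_thm_6_1_b_of_brandtDictionary`, with Takahashi's Thm. 2.3 on the discriminant
side (`hT2`) ALSO derived (`thm_2_3_disc_of_brandtDictionary`) from its dictionary `hDictDisc`
(Ribet's exact sequence / Čerednik–Drinfeld side, Takahashi Prop. 3.1 and Thm. 3.2 (a)). Trust base:
the seven named facts, the two dictionaries `hDict` (level side, `p ∥ M`, type `(M/p, Dp)`) and
`hDictDisc` (discriminant side, `p ∣ D`, type `(pM, D/p)`), and `h67small` — ALL of Takahashi's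
algebra (Lemma 2.2, Thm. 2.3 on both sides), Ribet–Takahashi's Thm. 2 for every `d`, the Eisenstein
divisibility and the whole of Pasten §6 being theorems. [cite: PastenShimura2024, Thm. 6.1 (b) p. 20, §6.3–6.9 pp. 21–25] [cite: Takahashi2001, §2 p. 78, Thm. 2.3 (p. 79), Prop. 3.1 and Thm. 3.2 (a) (p. 82), p. 84] [cite: Mazur1978, Thm. 1] -/
theorem PastenShimura2024_thm_6_1_b_of_brandtDictionaries
    (hMK : mazurKenku_exists_cyclic_isogeny) (hMO : mestreOesterle1989_thm_1)
    (hP : nonempty_shimuraParametrizationData)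
    (hRib : ribet1997_twoPowerFermat) (hDM : darmonMerel1997_denesEquation)
    (hFLT : FermatLastTheorem) (hMaz : mazur_isogeny_irreducible)
    (hDict : ∀ {N D M p m : ℕ}, p.Prime → M = p * m → ¬ p ∣ m → IsAdmissibleFactorization N D M →
      ∀ (X : ShimuraCurveData D M) (W : WeierstrassCurve ℚ) [W.IsElliptic], W.conductorNorm ℤ = N →
      ∀ (W' : WeierstrassCurve ℚ) [W'.IsElliptic] (P : ShimuraParametrizationData X W'),
        P.IsMinimalFor W →
      ∀ (S : Brandt.XiSetup m (D * p)) [Fintype (Brandt.ClassSet S.O)],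
        ∃ (Y : Submodule ℤ (Brandt.ClassSet S.O → ℤ)) (pb : ℤ →ₗ[ℤ] Y) (pf : Y →ₗ[ℤ] ℤ),
          (∀ (a : ℤ) (y : Y),
              ∑ i, (Brandt.weight S.O i : ℤ) * (pb a : Brandt.ClassSet S.O → ℤ) i *
                  (y : Brandt.ClassSet S.O → ℤ) i =
                ((W'.minimalDiscriminantNorm ℤ).factorization p : ℤ) * a * pf y) ∧
          (∀ a : ℤ, pf (pb a) = (P.deg : ℤ) * a) ∧
          Function.Surjective pf ∧
          (∀ (k : ℤ) (v : Brandt.ClassSet S.O → ℤ), k ≠ 0 → k • v ∈ Y → v ∈ Y) ∧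
          (∀ v : Brandt.ClassSet S.O → ℤ, ∑ i, v i = 0 → v ∈ Y) ∧
          Module.finrank ℤ
              (Brandt.eigenLattice (m * (D * p)) (Brandt.matrix S.O) (fun n => W'.LFunction n)) = 1 ∧
          (pb 1 : Brandt.ClassSet S.O → ℤ) ∈
            Brandt.eigenLattice (m * (D * p)) (Brandt.matrix S.O) (fun n => W'.LFunction n))
    (hDictDisc : ∀ {N D M p d : ℕ}, p.Prime → D = p * d → IsAdmissibleFactorization N D M →
      ∀ (X : ShimuraCurveData D M) (W : WeierstrassCurve ℚ) [W.IsElliptic], W.conductorNorm ℤ = N →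
      ∀ (W' : WeierstrassCurve ℚ) [W'.IsElliptic] (P : ShimuraParametrizationData X W'),
        P.IsMinimalFor W →
      ∀ (S : Brandt.XiSetup (p * M) d) [Fintype (Brandt.ClassSet S.O)],
        ∃ (Y : Submodule ℤ (Brandt.ClassSet S.O → ℤ)) (pb : ℤ →ₗ[ℤ] Y) (pf : Y →ₗ[ℤ] ℤ),
          (∀ (a : ℤ) (y : Y),
              ∑ i, (Brandt.weight S.O i : ℤ) * (pb a : Brandt.ClassSet S.O → ℤ) i *
                  (y : Brandt.ClassSet S.O → ℤ) i =
                ((W'.minimalDiscriminantNorm ℤ).factorization p : ℤ) * a * pf y) ∧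
          (∀ a : ℤ, pf (pb a) = (P.deg : ℤ) * a) ∧
          Function.Surjective pf ∧
          (∀ (k : ℤ) (v : Brandt.ClassSet S.O → ℤ), k ≠ 0 → k • v ∈ Y → v ∈ Y) ∧
          Module.finrank ℤ
              (Brandt.eigenLattice (p * M * d) (Brandt.matrix S.O) (fun n => W'.LFunction n)) = 1 ∧
          (pb 1 : Brandt.ClassSet S.O → ℤ) ∈
            Brandt.eigenLattice (p * M * d) (Brandt.matrix S.O) (fun n => W'.LFunction n))
    {S : Finset ℕ} (h2S : 2 ∈ S)
    (h67small : ∀ ℓ : ℕ, ℓ.Prime → ℓ ≤ 163 → ∃ β : ℕ,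
      ∀ (A : WeierstrassCurve ℚ) [A.IsElliptic],
        (∀ q : ℕ, q.Prime → q ∉ S → ¬ q ^ 2 ∣ A.conductorNorm ℤ) →
        ∃ r : ℕ, r.Prime ∧ ¬ r ∣ A.conductorNorm ℤ ∧
          ¬ ((ℓ ^ β : ℕ) : ℤ) ∣ (r + 1 : ℤ) - A.LFunction r) :
    PastenShimura2024_thm_6_1_b :=
  PastenShimura2024_thm_6_1_b_of_brandtDictionary hMK hMO hP hRib hDM hFLT hMaz hDict
    (fun hp hD hadm X W _ hWN W' _ P hP S =>
      thm_2_3_disc_of_brandtDictionary hDictDisc hp hD hadm X W hWN W' P hP S)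
    h2S h67small

end Literature.NumberTheory.Automorphic

end
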